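import Summits.FinalStateConjecture.FinalStateConjecture.Theorems.BartnikGapSettlingBondiBartnikRigidityStationaryKerrCollarRoute
import HarnessLib

/-!
# ORIENTED route statements of K1/K2 — line `direct-method-on-the-cone` (crux `BondiBartnikRigidity`,
# stmt-FinalStateConjecture-10807), wave-2 integration of lead a2 (workers F1 and K2b)

Wave 2 found the line's LIMIT-CATEGORY block (exact collar jet `truncDeviationCk … ≤ 0`, layer
embedding, core on the slice, maximality — K1, K2, F1, F4', F5, `ExactMinimiserKerrness`) to be
ORIENTATION-BLIND: the exact jet certifies the metric only, so the TIME-REVERSED exact Kerr /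
Schwarzschild development (a maximal vacuum development of `(h, −k)`) meets every hypothesis while every
`J⁺(C)`-placed conclusion fails (worker K2b: `stub-false` on the landed F5 `RoofDevelopmentExtension` by a
volume argument; the same witness refutes the landed F1 and the registered K2 and F4'; kernel certificate of
the mechanism `collarBlock_reverse` in the worker file published as
`Cruxes/…/Lines/direct_method_on_the_cone_K2b.lean`).  In the CRUX the leaf's `I⁺(S)` clause pins the
orientation; every line statement that drops the leaf must carry an orientation clause.  This file lands
the corrected statements:

* `K2Route.CollarFutureOriented` (worker K2b): on the strictly stationary shell of the slab the collar chart
  pushes `Λᵢe₀ = ∂_{t*ᵢ}` to a FUTURE-directed vector; `K2Route.CollarTimeOriented` (worker F1's (H8)): on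
  the whole slab the collar chart pushes the Kerr-star time orientation `ΛᵢV`, `V = −g♯dt*`, to a
  future-directed vector (the form the worker's sorry-free conditional proof of the corrected F1'
  `F1Route.SlabCauchyRigidity'` consumes; pointwise equivalent to the former on the shell under order-`0`
  exactness, since two timelike vectors with negative inner product lie in one cone);
* `K2Route.slabDiamondHalfK`, `K2Route.IsBoundaryCollarChart`, `K2Route.RoofDevelopmentExtensionCollar`
  (RECOMMENDED corrected F5: boundary-collar charts ⟹ the truncated causal future is Kerr; TRUE on paper by
  SPACELIKE MARCHING on the level sets of `t*`, conditional only on `choquetBruhat_geroch_exists_mghd_cauchy`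
  through the landed hypersurface localisation engine — no characteristic problem, no Rendall, no local
  uniqueness fact), `K2Route.K2Oriented` (the registered K2 + clause);
* `K2Route.OuterBoundaryCollarChartOriented` (F4' + clause in boundary-collar form — the OPEN core of K2)
  and the glue `K2Oriented_of_routeCollar` (closed form = the registered sub-goal
  `stub_stationaryKerrCollarExtensionOfRouteCollar`); the roof-chart forms `RoofDevelopmentExtensionOriented`
  (needs a corner lemma at `S₃`) and `K2Oriented_of_route` are in the worker file
  `Cruxes/…/Lines/direct_method_on_the_cone_K2b.lean`;
* `ExactMinimiserKerrnessOriented` — `ExactMinimiserKerrness` (Defs file) with both clauses: what the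
  oriented K1 and K2 compose to and what K3 must consume (the unoriented `ExactMinimiserKerrness` is
  plausibly FALSE by the reversed-Schwarzschild witness, report K2b §2(d)).

All `def … : Prop` here are route-posited statements of the line (tagged `[conjecture]`); nothing is
asserted.  References: Hawking–Ellis 1973, §6.5–§7.6 [HawkingEllis1973CUP]; Choquet-Bruhat–Geroch 1969
[ChoquetBruhatGeroch1969CMP]; Sbierski 2016 [Sbierski2016AHP]; Dafermos–Rodnianski 0811.0354 §5.1
[DafermosRodnianski2008].
-/

noncomputable section

-- D-0017: single-problem summit, `Summit.<S>.<S>.…` by design (cf. lakefile `weak.linter.dupNamespace`).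
set_option linter.dupNamespace false
-- instance search through the nested operator types of the Kerr chart facts
set_option maxSynthPendingDepth 3

open Set Filter Function Topology TopologicalSpace
open Literature.Geometry.Lorentzian
open scoped Manifold ContDiff Topology ENNReal

namespace Summit.FinalStateConjecture.FinalStateConjecture.Theorems.BondiBartnikRigidity.DirectMethod

namespace K2Route

universe u

variable {X : Type u} [TopologicalSpace X] [ChartedSpace E3 X] [IsManifold (𝓡 3) ∞ X]
  [ConnectedSpace X] {D : InitialDataSet (𝓡 3) X}


/-- **The orientation clause in the form consumed by the corrected F1'** (worker F1's (H8)): on the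
WHOLE thick slab `{t* = 0, M < r ≤ 3M}` of each collar the collar chart pushes the Kerr-star time
orientation `ΛᵢV`, `V = −g♯dt*` (`Kerr.timeVector`, future timelike for the boosted Kerr form
everywhere on `{r > M}`), to a FUTURE-directed vector of `𝒱`.  Pointwise equivalent on the shell to
`CollarFutureOriented` under order-`0` exactness (an isometric differential maps the cone containing both
`e₀` and `V` to one cone of `𝒱`).  A hypothesis clause; nothing is asserted. [conjecture] [folklore] -/
def CollarTimeOriented (𝒱 : VacuumCauchyDevelopment D) {N : ℕ} (M a : Fin N → ℝ)
    (mo : Fin N → lorentzGroup × E4) (B : Fin N → ModelBackground)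
    (Φ : ∀ i, (B i).domain → 𝒱.carrier) : Prop :=
  ∀ i, ∀ x ∈ (B i).truncTimeSlab (3 * M i) 0, 𝒱.timeOrientation.IsFutureDirected
    (mfderiv 𝓘(ℝ, E4) (𝓡 4) (Φ i) x
      (((mo i).1 : E4 ≃L[ℝ] E4) (Kerr.timeVector (M i) (a i) (poincareInv (mo i).1 (mo i).2 x.1))))

/-! ### The orientation clauses and the corrected F5 / K2 (worker K2b, re-checked) -/

/-- **The missing orientation clause of the limit-category block.**  On the strictly stationary
shell `{t* = 0, 2M < r ≤ 3M}` of each thick collar slab, the collar chart `Φᵢ` pushes the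
Kerr-star time translation `Λᵢ e₀ = ∂_{t*ᵢ}` of its frame — a future TIMELIKE vector of the
boosted Kerr form there (`g(∂_{t*}, ∂_{t*}) = −(1 − 2Mr/Σ) < 0` for `r > 2M`) — to a
FUTURE-directed vector of `𝒱`.  With the exact jet (C3) this says `dΦᵢ` preserves the time
orientation along the shell (hence, by connectedness, along the whole slab).  Without it the
block (C1)–(C3) + "core on the slice" is invariant under reversing the time orientation of `𝒱`,
which is how F1, F5 and the registered K2 fail (report §2).  A hypothesis clause; nothing is
asserted. [conjecture] [folklore] -/
def CollarFutureOriented (𝒱 : VacuumCauchyDevelopment D) {N : ℕ} (M : Fin N → ℝ)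
    (mo : Fin N → lorentzGroup × E4) (B : Fin N → ModelBackground)
    (Φ : ∀ i, (B i).domain → 𝒱.carrier) : Prop :=
  ∀ i, ∀ x ∈ (B i).truncTimeSlab (3 * M i) 0, 2 * M i < (B i).radius x.1 →
    𝒱.timeOrientation.IsFutureDirected
      (mfderiv 𝓘(ℝ, E4) (𝓡 4) (Φ i) x (((mo i).1 : E4 ≃L[ℝ] E4) (E4.basisVector 0)))

/-- The Kerr-side HONEST future inner diamond `Δ½ = {0 < t*, t* + r/2 < 3M/2}` of the slab
(`u = t* + r/2` is a time function of the star chart for `|a| < M`, since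
`Σ g⁻¹(du, du) = −Σ + Δ/4 < 0` on `{r > M}`; so `Δ½ ⊆ D⁺_Kerr(slab)`).  The landed
`slabDiamond = {0 < t*, t* + r < 3M}` is NOT inside `D⁺_Kerr(slab)` for `a ≠ 0`: `dv`,
`v = t* + r`, is spacelike off the axis (`conormalForm_neg_one_pos`, landed), so near `S₃` the
wedge `{t* > 0, v < 3M}` is wider than the domain-of-dependence wedge bounded by the ingoing
null normal hypersurface of `S₃` (report §1(f)). -/
def slabDiamondHalfK (M a : ℝ) : Set (Kerr.region a M) :=
  {y | 0 < y.1 0 ∧ y.1 0 + Kerr.radius a y.1 / 2 < 3 * M / 2}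

/-- **BOUNDARY-COLLAR CHART** (the hypothesis block the marching proof of F5 consumes): an exact
chart `Ψ` of the collar background on the pull-back of the Kerr-side one-sided neighbourhood
`E = Δ½ ∪ (O ∩ J⁺_K(slab)°)` of the WHOLE lower boundary `slab ∪ (C⁺_K(S₃) ∩ {r ≤ ρ})` of the
open causal future of the slab — `O` an open neighbourhood of the roof portion —, smooth, an open
embedding, image in `J`, deviation `0`, continuous up to `slab ∪ roof portion`, EQUAL TO `Φ₀` ON
THE WHOLE SLAB (not only on `S₃`), and mapping the roof portion into `∂J⁺(C)`.  It is
`IsRoofChart` with the diamond adjoined and clause 9 strengthened from `S₃` to the slab; F4'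
delivers it for free (its roof chart IS the continuation of the diamond chart of F1), and with it
F5 needs no corner-compatibility lemma at `Φ₀(S₃)`.  A hypothesis block; nothing is asserted.
[conjecture] [folklore] -/
def IsBoundaryCollarChart [Kerr.Facts] {𝒮 : Spacetime.{0} 4} (mo : lorentzGroup × E4) (M a : ℝ) (hM : 0 < M)
    (B : ModelBackground) (C J : Set 𝒮.carrier) (Φ₀ : B.domain → 𝒮.carrier) (ρ : ℝ)
    (O : Set (Kerr.region a M)) (Ψ : B.domain → 𝒮.carrier) : Prop :=
  IsOpen O ∧ roofK M a hM ∩ {y | Kerr.radius a y.1 ≤ ρ} ⊆ O ∧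
  let E : Set (Kerr.region a M) := slabDiamondHalfK M a ∪ (O ∩ interior (JK M a hM (slabK M a)))
  ContMDiffOn 𝓘(ℝ, E4) (𝓡 4) ∞ Ψ (pullK mo M a B E) ∧
  IsOpenEmbedding ((pullK mo M a B E).restrict Ψ) ∧
  Ψ '' pullK mo M a B E ⊆ J ∧
  supCkENorm (Subtype.val '' pullK mo M a B E) 0 (𝒮.deviationExtend B Ψ) ≤ 0 ∧
  ContinuousOn Ψ (pullK mo M a B (E ∪ slabK M a ∪ (O ∩ roofK M a hM))) ∧
  Ψ '' pullK mo M a B (O ∩ roofK M a hM) ⊆ frontier (𝒮.metric.causalFuture 𝒮.timeOrientation C) ∧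
  ∀ x ∈ pullK mo M a B (slabK M a), Ψ x = Φ₀ x

/-- **F5, corrected (recommended form): boundary-collar charts ⟹ the truncated causal future is
Kerr.**  As `RoofDevelopmentExtensionOriented` but with `IsBoundaryCollarChart` in place of
`IsRoofChart`.  TRUE on paper by SPACELIKE marching (report §4): level by level, the exact slice
piece `{t* = τ} ∩ J⁺_K(slab)°` is an acausal hypersurface datum of `𝒱` (past-set transfer),
whose Kerr kite development is realised inside the MAXIMAL `𝒱` by the landed hypersurface
localisation engine (`CaptureSufficesC2.Sketch.stub_hypersurfaceMGHDRealised_of_choquetBruhatGeroch`,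
conditional on `choquetBruhat_geroch_exists_mghd_cauchy` only), glued to the previous chart by
one-jet rigidity (`IsIsometricImmersion.eq_of_oneJet_eq`), the strip lost near the roof at each
step being refilled by the collar.  Route-posited statement; nothing is asserted.
[conjecture] [folklore] -/
def RoofDevelopmentExtensionCollar : Prop :=
  ∀ [Kerr.Facts] (k' : ℕ), 1 ≤ k' →
    ∀ (X : Type) [TopologicalSpace X] [ChartedSpace E3 X] [IsManifold (𝓡 3) ∞ X]
      [T2Space X] [SecondCountableTopology X] [ConnectedSpace X]
      (D : InitialDataSet (𝓡 3) X) (𝒱 : VacuumCauchyDevelopment D)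
      (M a : Fin 1 → ℝ) (p : 𝒱.carrier) (mo : Fin 1 → lorentzGroup × E4)
      (B : Fin 1 → ModelBackground) (Φ : ∀ i, (B i).domain → 𝒱.carrier)
      (hmax : 𝒱.IsMaximal) (hpar : ∀ i, 0 < M i ∧ |a i| < M i),
    (∃ i, p ∈ Φ i '' (B i).truncTimeSlab (3 * M i) 0) →
    (∀ i, B i = starBackground (mo i).1 (mo i).2 (M i) (a i)
      (fun x => Kerr.radius (a i) (poincareInv (mo i).1 (mo i).2 x))) →
    (∀ i, ContMDiffOn 𝓘(ℝ, E4) (𝓡 4) ∞ (Φ i)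
        {x | -1 < (B i).time x.1 ∧ (B i).time x.1 < 1 ∧ (B i).radius x.1 < 3 * M i + 1} ∧
      IsOpenEmbedding ({x | -1 < (B i).time x.1 ∧ (B i).time x.1 < 1 ∧
        (B i).radius x.1 < 3 * M i + 1}.restrict (Φ i))) →
    (∀ i, 𝒱.toSpacetime.truncDeviationCk (B i) (Φ i) k' (3 * M i) 0 ≤ 0) →
    CollarFutureOriented 𝒱 M mo B Φ →
    collarCore M p B Φ ⊆ range 𝒱.embed →
    (∀ ρ : ℝ, ∃ (O : Set (Kerr.region (a 0) (M 0))) (Ψ : (B 0).domain → 𝒱.carrier),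
      IsBoundaryCollarChart (mo 0) (M 0) (a 0) (hpar 0).1 (B 0) (collarCore M p B Φ)
        (𝒱.metric.causalFuture 𝒱.timeOrientation (collarCore M p B Φ)) (Φ 0) ρ O Ψ) →
    ∀ ρ T₀ : ℝ, ∃ Ψ : (B 0).domain → 𝒱.carrier,
      ContMDiffOn 𝓘(ℝ, E4) (𝓡 4) ∞ Ψ (pullK (mo 0) (M 0) (a 0) (B 0) (truncFutureK (M 0) (a 0) (hpar 0).1 ρ T₀)) ∧
      IsOpenEmbedding ((pullK (mo 0) (M 0) (a 0) (B 0) (truncFutureK (M 0) (a 0) (hpar 0).1 ρ T₀)).restrict Ψ) ∧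
      Ψ '' pullK (mo 0) (M 0) (a 0) (B 0) (truncFutureK (M 0) (a 0) (hpar 0).1 ρ T₀) ⊆
        𝒱.metric.causalFuture 𝒱.timeOrientation (collarCore M p B Φ) ∧
      supCkENorm (Subtype.val '' pullK (mo 0) (M 0) (a 0) (B 0) (truncFutureK (M 0) (a 0) (hpar 0).1 ρ T₀)) 0
        (𝒱.toSpacetime.deviationExtend (B 0) Ψ) ≤ 0

/-- **K2, corrected**: the registered K2 signature with the orientation clause inserted (after the
exact-jet clause).  The registered K2 is false by the same time-reversed witness (report §2(c)).
Route-posited statement; nothing is asserted. [conjecture] [folklore] -/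
def K2Oriented : Prop :=
  ∀ (k' : ℕ), 2 ≤ k' →
    ∀ (X : Type) [TopologicalSpace X] [ChartedSpace E3 X] [IsManifold (𝓡 3) ∞ X]
      [T2Space X] [SecondCountableTopology X] [ConnectedSpace X]
      (D : InitialDataSet (𝓡 3) X) (𝒱 : VacuumCauchyDevelopment D)
      (M a : Fin 1 → ℝ) (p : 𝒱.carrier) (mo : Fin 1 → lorentzGroup × E4)
      (B : Fin 1 → ModelBackground) (Φ : ∀ i, (B i).domain → 𝒱.carrier),
    𝒱.IsMaximal → (∀ i, 0 < M i ∧ |a i| < M i) →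
    (∃ i, p ∈ Φ i '' (B i).truncTimeSlab (3 * M i) 0) →
    (∀ i, B i = starBackground (mo i).1 (mo i).2 (M i) (a i)
      (fun x => Kerr.radius (a i) (poincareInv (mo i).1 (mo i).2 x))) →
    (∀ i, ContMDiffOn 𝓘(ℝ, E4) (𝓡 4) ∞ (Φ i)
        {x | -1 < (B i).time x.1 ∧ (B i).time x.1 < 1 ∧ (B i).radius x.1 < 3 * M i + 1} ∧
      IsOpenEmbedding ({x | -1 < (B i).time x.1 ∧ (B i).time x.1 < 1 ∧
        (B i).radius x.1 < 3 * M i + 1}.restrict (Φ i))) →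
    (∀ i, 𝒱.toSpacetime.truncDeviationCk (B i) (Φ i) k' (3 * M i) 0 ≤ 0) →
    CollarFutureOriented 𝒱 M mo B Φ →
    collarCore M p B Φ ⊆ range 𝒱.embed →
    (∃ m : ℝ, 𝒱.toCauchyDevelopment.HasCutBondiMass (collarCore M p B Φ) m) →
    ∀ [𝒱.metric.toPseudoRiemannianMetric.HasLeviCivita],
    ∀ (ξ : Π x : 𝒱.carrier, TangentSpace (𝓡 4) x),
    𝒱.metric.IsKillingFieldOn ξ (interior (killingDomain 𝒱 M p B Φ)) →
    (∃ (τ₁ r₁ r₂ : ℝ) (Ψ : (B 0).domain → 𝒱.carrier),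
        0 < τ₁ ∧ 2 * M 0 ≤ r₁ ∧ r₁ < r₂ ∧ r₂ ≤ 3 * M 0 ∧
        IsNearModelBox 𝒱.toSpacetime (B 0) k' 0 0 τ₁ r₁ r₂ (interior (killingDomain 𝒱 M p B Φ)) Ψ ∧
        ∀ x ∈ coordBox (B 0) 0 τ₁ r₁ r₂,
          ξ (Ψ x) = mfderiv 𝓘(ℝ, E4) (𝓡 4) Ψ x (((mo 0).1 : E4 ≃L[ℝ] E4) (E4.basisVector 0))) →
    ∀ (k : ℕ) (R T : ℝ), ∃ (τ : ℝ) (Ψ : (B 0).domain → 𝒱.carrier),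
      IsNearModelBox 𝒱.toSpacetime (B 0) k 0 τ (τ + T) (M 0) (R + 1)
        (𝒱.metric.causalFuture 𝒱.timeOrientation (collarCore M p B Φ)) Ψ


/-! ### F4' corrected (the OPEN core of K2), boundary-collar form -/

/-- **F4' corrected, boundary-collar form — `OuterBoundaryCollarChartOriented`**: the landed `OuterRoofChart` with the orientation clause
`CollarFutureOriented` inserted after the exact-jet clause (the unoriented F4' is refuted, modulo a
`HasCutBondiMass` check, by the reversed-Schwarzschild witness), and a conclusion that delivers for every `ρ` a BOUNDARY-COLLAR chart (`IsBoundaryCollarChart`: the roof chart with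
the honest half-slope diamond adjoined and agreement with `Φ₀` on the whole slab — free for the intended
producer, which continues the diamond chart of F1) on which `ξ = dΨ(Λe₀)` over the open part.  This is
the form the recommended corrected F5 (`RoofDevelopmentExtensionCollar`, marching) consumes.  OPEN on
paper.  Route-posited statement; nothing is asserted. [conjecture] [folklore] -/
def OuterBoundaryCollarChartOriented : Prop :=
  ∀ [Kerr.Facts] (k' : ℕ), 2 ≤ k' →
    ∀ (X : Type) [TopologicalSpace X] [ChartedSpace E3 X] [IsManifold (𝓡 3) ∞ X]
      [T2Space X] [SecondCountableTopology X] [ConnectedSpace X]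
      (D : InitialDataSet (𝓡 3) X) (𝒱 : VacuumCauchyDevelopment D)
      (M a : Fin 1 → ℝ) (p : 𝒱.carrier) (mo : Fin 1 → lorentzGroup × E4)
      (B : Fin 1 → ModelBackground) (Φ : ∀ i, (B i).domain → 𝒱.carrier)
      (hmax : 𝒱.IsMaximal) (hpar : ∀ i, 0 < M i ∧ |a i| < M i),
    (∃ i, p ∈ Φ i '' (B i).truncTimeSlab (3 * M i) 0) →
    (∀ i, B i = starBackground (mo i).1 (mo i).2 (M i) (a i)
      (fun x => Kerr.radius (a i) (poincareInv (mo i).1 (mo i).2 x))) →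
    (∀ i, ContMDiffOn 𝓘(ℝ, E4) (𝓡 4) ∞ (Φ i)
        {x | -1 < (B i).time x.1 ∧ (B i).time x.1 < 1 ∧ (B i).radius x.1 < 3 * M i + 1} ∧
      IsOpenEmbedding ({x | -1 < (B i).time x.1 ∧ (B i).time x.1 < 1 ∧
        (B i).radius x.1 < 3 * M i + 1}.restrict (Φ i))) →
    (∀ i, 𝒱.toSpacetime.truncDeviationCk (B i) (Φ i) k' (3 * M i) 0 ≤ 0) →
    CollarFutureOriented 𝒱 M mo B Φ →
    collarCore M p B Φ ⊆ range 𝒱.embed →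
    (∃ m : ℝ, 𝒱.toCauchyDevelopment.HasCutBondiMass (collarCore M p B Φ) m) →
    ∀ [𝒱.metric.toPseudoRiemannianMetric.HasLeviCivita],
    ∀ (ξ : Π x : 𝒱.carrier, TangentSpace (𝓡 4) x),
    𝒱.metric.IsKillingFieldOn ξ (interior (killingDomain 𝒱 M p B Φ)) →
    (∃ (τ₁ r₁ r₂ : ℝ) (Ψ : (B 0).domain → 𝒱.carrier),
        0 < τ₁ ∧ 2 * M 0 ≤ r₁ ∧ r₁ < r₂ ∧ r₂ ≤ 3 * M 0 ∧
        IsNearModelBox 𝒱.toSpacetime (B 0) k' 0 0 τ₁ r₁ r₂ (interior (killingDomain 𝒱 M p B Φ)) Ψ ∧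
        ∀ x ∈ coordBox (B 0) 0 τ₁ r₁ r₂,
          ξ (Ψ x) = mfderiv 𝓘(ℝ, E4) (𝓡 4) Ψ x (((mo 0).1 : E4 ≃L[ℝ] E4) (E4.basisVector 0))) →
    ∀ ρ : ℝ, ∃ (O : Set (Kerr.region (a 0) (M 0))) (Ψ : (B 0).domain → 𝒱.carrier),
      IsBoundaryCollarChart (mo 0) (M 0) (a 0) (hpar 0).1 (B 0) (collarCore M p B Φ)
        (interior (killingDomain 𝒱 M p B Φ)) (Φ 0) ρ O Ψ ∧
      ∀ x ∈ pullK (mo 0) (M 0) (a 0) (B 0) (O ∩ interior (JK (M 0) (a 0) (hpar 0).1 (slabK (M 0) (a 0)))),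
        ξ (Ψ x) = mfderiv 𝓘(ℝ, E4) (𝓡 4) Ψ x (((mo 0).1 : E4 ≃L[ℝ] E4) (E4.basisVector 0))


/-! ### Glues for the corrected route -/

/-- **The corrected K2 follows from the boundary-collar F4', the recommended corrected F5 and the landed
F6** (same plumbing; the boundary-collar chart's image is moved from `(killingDomain)°` into `J⁺(C)` by
`killingDomain ⊆ J⁺(C)`). -/
theorem K2Oriented_of_routeCollar (h4 : OuterBoundaryCollarChartOriented) (h5 : RoofDevelopmentExtensionCollar)
    (h6 : KerrLateBoxPlacement) : K2Oriented := by
  haveI : Kerr.Facts :=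
    ⟨Kerr.isConnected_region_holds, Kerr.contMDiff_bilin_holds, Kerr.contMDiff_timeVector_holds⟩
  intro k' hk' X _ _ _ _ _ _ D 𝒱 M a p mo B Φ hmax hpar hp hB hΦ hdev hor hCX hcut _ ξ hξ hbox k R T
  have hroof := h4 k' hk' X D 𝒱 M a p mo B Φ hmax hpar hp hB hΦ hdev hor hCX hcut ξ hξ hbox
  have hroof' : ∀ ρ : ℝ, ∃ (O : Set (Kerr.region (a 0) (M 0))) (Ψ : (B 0).domain → 𝒱.carrier),
      IsBoundaryCollarChart (mo 0) (M 0) (a 0) (hpar 0).1 (B 0) (collarCore M p B Φ)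
        (𝒱.metric.causalFuture 𝒱.timeOrientation (collarCore M p B Φ)) (Φ 0) ρ O Ψ := by
    intro ρ
    obtain ⟨O, Ψ, ⟨hO, hsub, hs, he, hJ, hd, hc, hfr, hS⟩, -⟩ := hroof ρ
    exact ⟨O, Ψ, hO, hsub, hs, he,
      hJ.trans (interior_subset.trans (killingDomain_subset_causalFuture 𝒱 M p B Φ)), hd, hc, hfr, hS⟩
  have hext := h5 k' (le_trans one_le_two hk') X D 𝒱 M a p mo B Φ hmax hpar hp hB hΦ hdev hor hCX hroof'
  obtain ⟨τ, ρ, T₀, hplace⟩ := h6 (M 0) (a 0) R T (hpar 0).1 (hpar 0).2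
  obtain ⟨Ψ, hs, he, hJ, hd⟩ := hext ρ T₀
  refine ⟨τ, Ψ, ?_⟩
  have hsub : coordBox (B 0) τ (τ + T) (M 0) (R + 1) ⊆
      pullK (mo 0) (M 0) (a 0) (B 0) (truncFutureK (M 0) (a 0) (hpar 0).1 ρ T₀) :=
    (coordBox_subset_pullK_boxK (hB 0) τ (τ + T) (M 0) (R + 1)).trans (pullK_mono _ _ _ _ hplace)
  have hopen : IsOpen (coordBox (B 0) τ (τ + T) (M 0) (R + 1)) := by
    rw [hB 0]
    exact isOpen_coordBox (continuous_time_starBackground _ _ _ _ _)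
      (continuous_radius_starBackground _ _ _ _) _ _ _ _
  exact isNearModelBox_of_exactOn hs he hJ hd hsub hopen
    (isOpen_image_val_coordBox_of_eq_starBackground (hB 0) _ _ _ _) k

end K2Route

/-! ### The oriented exact-minimiser Kerrness (what the oriented K1 and K2 compose to) -/

/-- **`ExactMinimiserKerrnessOriented`** — verbatim `ExactMinimiserKerrness` (Defs file) with the two
orientation clauses `K2Route.CollarFutureOriented`, `K2Route.CollarTimeOriented` inserted after the exact
collar block: an exact Bondi–Bartnik minimiser with an exact, FUTURE-ORIENTED thick Kerr collar, in any
maximal vacuum development of any smooth data, contains exact Kerr-star boxes of every radius and length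
inside `J⁺(C)`.  The unoriented statement is plausibly false (reversed Schwarzschild: competitors exist,
late ingoing boxes do not fit in `J⁻(slab)`).  The line's intermediate target, consumed by K3; OPEN.
Route-posited statement; nothing is asserted. [conjecture] [folklore] -/
def ExactMinimiserKerrnessOriented : Prop :=
  ∀ (k' : ℕ), 2 ≤ k' →
    ∀ (X : Type) [TopologicalSpace X] [ChartedSpace E3 X] [IsManifold (𝓡 3) ∞ X]
      [T2Space X] [SecondCountableTopology X] [ConnectedSpace X]
      (D : InitialDataSet (𝓡 3) X) (𝒱 : VacuumCauchyDevelopment D)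
      (M a : Fin 1 → ℝ) (p : 𝒱.carrier) (mo : Fin 1 → lorentzGroup × E4)
      (B : Fin 1 → ModelBackground) (Φ : ∀ i, (B i).domain → 𝒱.carrier),
    𝒱.IsMaximal → (∀ i, 0 < M i ∧ |a i| < M i) →
    (∃ i, p ∈ Φ i '' (B i).truncTimeSlab (3 * M i) 0) →
    collarCore M p B Φ ⊆ range 𝒱.embed →
    𝒱.NearKerrCollarCore k' 0 0 1 M a univ p mo B Φ →
    K2Route.CollarFutureOriented 𝒱 M mo B Φ → K2Route.CollarTimeOriented 𝒱 M a mo B Φ →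
    (∃ m' : ℝ, 𝒱.IsCompetitorMass (collarCore M p B Φ) m') →
    ∀ (k : ℕ) (R T : ℝ), ∃ (τ : ℝ) (Ψ : (B 0).domain → 𝒱.carrier),
      IsNearModelBox 𝒱.toSpacetime (B 0) k 0 τ (τ + T) (M 0) (R + 1)
        (𝒱.metric.causalFuture 𝒱.timeOrientation (collarCore M p B Φ)) Ψ

/-- **Registered sub-goal of the line** (`stub_stationaryKerrCollarExtensionOfRouteCollar`): closed form
of the boundary-collar glue of the corrected K2. [conjecture] [folklore] -/
theorem stub_stationaryKerrCollarExtensionOfRouteCollar : K2Route.OuterBoundaryCollarChartOriented → K2Route.RoofDevelopmentExtensionCollar → K2Route.KerrLateBoxPlacement → K2Route.K2Oriented :=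
  fun h4 h5 h6 ↦ K2Route.K2Oriented_of_routeCollar h4 h5 h6

end Summit.FinalStateConjecture.FinalStateConjecture.Theorems.BondiBartnikRigidity.DirectMethod

end
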